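import Summits.ValiantsHypothesis.ValiantsHypothesis.Theorems.OrderedCountWindowSegmentRank
import HarnessLib

/-!
# Ordered count window — the ALPHABET-2 PAIR RESERVOIR (lens 6, g8, K3)

The restriction of `per_N` that drives the reservoir theorem (`Theorems/OrderedCountWindowReservoir.lean`):
given a set `S` of columns and a bijection `e : S ≃ Sᶜ` (a perfect matching of the columns), ZERO every
entry of the `N × N` matrix outside the `2 × 2` blocks `{s, e s} × {s, e s}` (rows named after columns).
In the block-respecting substitution language of `Theorems/OrderedCountWindowTransfer.lean` this is the
substitution with every column variable (`γ = some`), alphabet `Fin 2`, and row maps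
`ρ c 0 = c`, `ρ c 1 = partner c` (`pairRow`).  Its coefficient tensor is the PAIR TENSOR
`pairTensor S e j = [∀ s ∈ S, j s = j (e s)]` (`transferTensor_some`, `perWord_pairRow`: the word
`c ↦ ρ c (j c)` is a permutation iff it swaps or fixes every pair), and the flattening of the pair
tensor across `S` is a PERMUTATION MATRIX of size `2^|Sᶜ|` (`rank_setFlattening_pairTensor`).
No constants, no factorials, characteristic-free; `det_N` restricts the same way up to signs.

Also here: the transfer with the block orders and widths EXPOSED (`transfer_uniform`: the SAME `σ i, w i`
serve every substitution — needed because the matching is chosen after seeing the orders).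

[cite: ChatterjeeKushSarafShpilka2024, §1.3 (the hard polynomial `F_{n,n} = ∏ inner products` — here
replaced by a restriction of `per` itself), Claim 1] [cite: ArvindRaja2016, §3, Thm 7]
[cite: Nisan1991Noncommutative, §2]
-/

noncomputable section

namespace Summit.ValiantsHypothesis.ValiantsHypothesis.Theorems.OrderedCountWindow

open Literature.Computability.AlgebraicComplexity Matrix

variable {F : Type*} [Field F]

/-! ## §1 Transfer with the orders and widths exposed -/

/-- **Uniform transfer.** A sum of `t` ordered programs for `per_N` of total width `≤ W` yields block
orders `σ i` and widths `w i` (`∑ w i ≤ W`) such that for EVERY block-respecting substitution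
`(γ, ρ, B)` the projected tensor is the sum of `t` layer-local programs, program `i` having width `w i`
and reading block `γ (σ i p)` at layer `p`. [cite: ChatterjeeKushSarafShpilka2024, §1.2 (closure of
ΣosmABP under set-multilinear projections, implicit); ArvindRaja2016, §3] -/
theorem transfer_uniform {N t W : ℕ} (h : IsSumOrdered F N t W) :
    ∃ (σ : Fin t → Equiv.Perm (Fin N)) (w : Fin t → ℕ), ∑ i, w i ≤ W ∧
      ∀ (d n : ℕ) (γ : Fin N → Option (Fin d)) (ρ : Fin d → Fin n → Fin N) (B : Fin N → Fin N → F),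
        ∃ B' : Fin t → (Fin d → Fin n) → F,
          (∀ i, HasOsmWidthLE (w i) (fun p => γ (σ i p)) (B' i)) ∧
            ∀ j, ∑ i, B' i j = transferTensor γ ρ B j := by
  classical
  obtain ⟨σ, w, Bt, hBt, hsum, hper⟩ := h
  choose C u v hC using hBt
  refine ⟨σ, w, hsum, fun d n γ ρ B => ⟨fun i j => u i ⬝ᵥ
      ((List.ofFn fun p => ∑ r, substMatrix γ ρ B j r (σ i p) • C i p r).prod *ᵥ v i),
    fun i => ?_, fun j => ?_⟩⟩
  · -- each summand is a layer-local program of the same width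
    refine ⟨fun p j => ∑ r, substMatrix γ ρ B j r (σ i p) • C i p r, u i, v i,
      fun p j j' hjj' => ?_, fun j => rfl⟩
    exact Finset.sum_congr rfl fun r _ => by rw [substMatrix_congr γ ρ B hjj']
  · -- the identity `∑_i (substituted program i) = T`
    have key : ∀ i, u i ⬝ᵥ ((List.ofFn fun p =>
        ∑ r, substMatrix γ ρ B j r (σ i p) • C i p r).prod *ᵥ v i) =
        ∑ J : Fin N → Fin N, Bt i (J ∘ ⇑(σ i)) * ∏ c, substMatrix γ ρ B j (J c) c := by
      intro i
      have h1 : ∑ J : Fin N → Fin N, Bt i (J ∘ ⇑(σ i)) * ∏ c, substMatrix γ ρ B j (J c) c =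
          ∑ J' : Fin N → Fin N, Bt i J' * ∏ p, substMatrix γ ρ B j (J' p) (σ i p) := by
        refine Fintype.sum_equiv ((σ i).symm.arrowCongr (Equiv.refl (Fin N))) _ _ fun J => ?_
        have hJ : ((σ i).symm.arrowCongr (Equiv.refl (Fin N))) J = J ∘ ⇑(σ i) := by
          ext p; simp
        rw [hJ, ← Equiv.prod_comp (σ i) (fun c => substMatrix γ ρ B j (J c) c)]
        rfl
      have h2 : ∀ J' : Fin N → Fin N, Bt i J' * ∏ p, substMatrix γ ρ B j (J' p) (σ i p) =
          u i ⬝ᵥ ((List.ofFn fun p => substMatrix γ ρ B j (J' p) (σ i p) • C i p (J' p)).prod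
            *ᵥ v i) := by
        intro J'
        rw [hC i J', listProd_ofFn_smul (fun p => substMatrix γ ρ B j (J' p) (σ i p))
          (fun p => C i p (J' p)), Matrix.smul_mulVec, dotProduct_smul, smul_eq_mul, mul_comm]
      rw [h1, listProd_ofFn_sum (fun p r => substMatrix γ ρ B j r (σ i p) • C i p r),
        Matrix.sum_mulVec, dotProduct_sum]
      exact Finset.sum_congr rfl fun J' _ => (h2 J').symm
    simp only [key, transferTensor]
    rw [Finset.sum_comm]
    refine Finset.sum_congr rfl fun J _ => ?_
    rw [← Finset.sum_mul, hper J]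

/-- With every column variable (`γ = some`), the projected tensor at `j` is the permanent word
indicator of the row word `c ↦ ρ c (j c)`. [cite: Nisan1991Noncommutative, §4] -/
theorem transferTensor_some {N n : ℕ} (ρ : Fin N → Fin n → Fin N) (B : Fin N → Fin N → F)
    (j : Fin N → Fin n) :
    transferTensor (fun c : Fin N => some c) ρ B j =
      NisanPermanent.perWord F N (fun c => ρ c (j c)) := by
  classical
  unfold transferTensor substMatrix
  simp only [Option.elim_some, Fintype.prod_boole]
  have hiff : ∀ J : Fin N → Fin N, (∀ c, J c = ρ c (j c)) ↔ J = fun c => ρ c (j c) :=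
    fun J => funext_iff.symm
  simp_rw [hiff]
  simp

/-! ## §2 The pair substitution -/

section Pair

variable {N : ℕ} (S : Finset (Fin N)) (e : {c // c ∈ S} ≃ {c // c ∉ S})

/-- The PARTNER of a column under the matching `e : S ≃ Sᶜ` (a fixed-point-free involution).
[cite: ChatterjeeKushSarafShpilka2024, §1.3 (the pairing `w ∈ {±1}^d ↦ A(w)`)] -/
def partner (c : Fin N) : Fin N :=
  if h : c ∈ S then (e ⟨c, h⟩).1 else (e.symm ⟨c, h⟩).1

/-- The partner of a column of `S`. [folklore] -/
theorem partner_of_mem {c : Fin N} (h : c ∈ S) : partner S e c = (e ⟨c, h⟩).1 := by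
  unfold partner
  rw [dif_pos h]

/-- The partner of a column outside `S`. [folklore] -/
theorem partner_of_not_mem {c : Fin N} (h : c ∉ S) : partner S e c = (e.symm ⟨c, h⟩).1 := by
  unfold partner
  rw [dif_neg h]

/-- `partner` is an involution. [folklore] -/
theorem partner_partner (c : Fin N) : partner S e (partner S e c) = c := by
  by_cases h : c ∈ S
  · rw [partner_of_mem S e h, partner_of_not_mem S e (e ⟨c, h⟩).2]
    simp
  · rw [partner_of_not_mem S e h, partner_of_mem S e (e.symm ⟨c, h⟩).2]
    simp

/-- A column and its partner lie on opposite sides of `S`; in particular they differ. [folklore] -/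
theorem partner_ne (c : Fin N) : partner S e c ≠ c := by
  by_cases h : c ∈ S
  · rw [partner_of_mem S e h]
    intro h'
    have h2 := (e ⟨c, h⟩).2
    rw [h'] at h2
    exact h2 h
  · rw [partner_of_not_mem S e h]
    intro h'
    have h2 := (e.symm ⟨c, h⟩).2
    rw [h'] at h2
    exact h h2

/-- The ROW MAP of the pair substitution: letter `0` of column `c` is the diagonal entry `(c, c)`,
letter `1` the entry `(partner c, c)`; everything else of `per_N` is zeroed.
[cite: ChatterjeeKushSarafShpilka2024, §1.3; ArvindRaja2016, §3] -/
def pairRow (c : Fin N) (a : Fin 2) : Fin N :=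
  if a = 0 then c else partner S e c

/-- The PAIR TENSOR: `1` if the letters of every matched pair agree, `0` otherwise.
[cite: ChatterjeeKushSarafShpilka2024, §1.3 (`F_{n,n}` with inner products replaced by equality)] -/
def pairTensor (j : Fin N → Fin 2) : F :=
  if ∀ s : {c // c ∈ S}, j s.1 = j (e s).1 then 1 else 0

/-- Under "letters of matched pairs agree" every column has the same letter as its partner. [folklore] -/
theorem apply_partner_eq {j : Fin N → Fin 2} (hj : ∀ s : {c // c ∈ S}, j s.1 = j (e s).1)
    (c : Fin N) : j (partner S e c) = j c := by
  by_cases h : c ∈ S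
  · rw [partner_of_mem S e h]
    exact (hj ⟨c, h⟩).symm
  · rw [partner_of_not_mem S e h]
    have := hj (e.symm ⟨c, h⟩)
    simpa using this

/-- **The restricted permanent is the pair tensor**: the row word `c ↦ pairRow c (j c)` of the pair
substitution is a permutation iff the letters of every matched pair agree (then it swaps the pairs
with letter `1` and fixes the others; otherwise some pair collides). [cite: ArvindRaja2016, Thm 7
(proof: the test words); ChatterjeeKushSarafShpilka2024, §1.3] -/
theorem perWord_pairRow (j : Fin N → Fin 2) :
    NisanPermanent.perWord F N (fun c => pairRow S e c (j c)) = pairTensor S e j := by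
  classical
  unfold NisanPermanent.perWord pairTensor
  by_cases hj : ∀ s : {c // c ∈ S}, j s.1 = j (e s).1
  · -- the row word is an involution, hence injective
    rw [if_pos hj, if_pos]
    have hinv : Function.Involutive fun c => pairRow S e c (j c) := by
      intro c
      by_cases h0 : j c = 0
      · simp only [pairRow, h0, if_true]
      · simp only [pairRow, h0, if_false, apply_partner_eq S e hj c, partner_partner]
    exact hinv.injective
  · rw [if_neg hj, if_neg]
    push Not at hj
    obtain ⟨s, hs⟩ := hj
    intro hinj
    have hse : (s.1 : Fin N) ≠ (e s).1 := fun h' => (e s).2 (h' ▸ s.2)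
    apply hse
    apply hinj
    -- the two columns of the pair are sent to the same row
    show pairRow S e s.1 (j s.1) = pairRow S e (e s).1 (j (e s).1)
    have hps : partner S e s.1 = (e s).1 := by
      rw [partner_of_mem S e s.2]
    have hpe : partner S e (e s).1 = s.1 := by
      rw [partner_of_not_mem S e (e s).2]
      simp
    by_cases h0 : j s.1 = 0
    · have h1 : j (e s).1 ≠ 0 := fun h1 => hs (h0.trans h1.symm)
      simp only [pairRow, h0, h1, if_true, if_false, hpe]
    · have h1 : j (e s).1 = 0 := by
        by_contra h1
        exact hs ((Fin.eq_one_of_ne_zero _ h0).trans (Fin.eq_one_of_ne_zero _ h1).symm)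
      simp only [pairRow, h0, h1, if_true, if_false, hps]

/-- **The flattening of the pair tensor across `S` is a permutation matrix**: entry `(x, y)` is
`[x = y ∘ e]`, so its rank is `2^|Sᶜ|`. [cite: ChatterjeeKushSarafShpilka2024, Claim 1 (full rank of
`M_{F,S}` for balanced `S`); ArvindRaja2016, Thm 7 (the identity matrix of test words)] -/
theorem rank_setFlattening_pairTensor :
    (setFlattening S (pairTensor (F := F) S e)).rank = 2 ^ (Fintype.card {c // c ∉ S}) := by
  classical
  -- the bijection rows → columns: `x ↦ x ∘ e.symm`
  let f : ({c // c ∈ S} → Fin 2) ≃ ({c // c ∉ S} → Fin 2) := e.arrowCongr (Equiv.refl _)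
  have hf : ∀ x y, (∀ s : {c // c ∈ S}, glueWord S x y s.1 = glueWord S x y (e s).1) ↔ f x = y := by
    intro x y
    have hg1 : ∀ s : {c // c ∈ S}, glueWord S x y s.1 = x s := fun s =>
      glueWord_of_mem S x y s.2
    have hg2 : ∀ s : {c // c ∈ S}, glueWord S x y (e s).1 = y (e s) := fun s =>
      glueWord_of_not_mem S x y (e s).2
    simp only [hg1, hg2]
    constructor
    · intro h
      funext c'
      have := h (e.symm c')
      simp only [Equiv.apply_symm_apply] at this
      simpa [f] using this
    · rintro rfl s
      simp [f]
  have hM : setFlattening S (pairTensor (F := F) S e) =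
      (1 : Matrix ({c // c ∉ S} → Fin 2) ({c // c ∉ S} → Fin 2) F).submatrix f id := by
    ext x y
    rw [setFlattening_apply, Matrix.submatrix_apply, Matrix.one_apply]
    unfold pairTensor
    simp only [hf x y, id]
    exact if_congr Iff.rfl rfl rfl
  rw [hM, show ((1 : Matrix ({c // c ∉ S} → Fin 2) ({c // c ∉ S} → Fin 2) F).submatrix ⇑f id) =
      (1 : Matrix _ _ F).submatrix ⇑f ⇑(Equiv.refl _) from rfl, Matrix.rank_submatrix,
    Matrix.rank_one, Fintype.card_fun, Fintype.card_fin]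

/-- With `|S| = |Sᶜ| = P` (so `N = 2P`) the rank is `2^P`. [folklore] -/
theorem rank_setFlattening_pairTensor_eq {P : ℕ} (hSc : Fintype.card {c // c ∉ S} = P) :
    (setFlattening S (pairTensor (F := F) S e)).rank = 2 ^ P := by
  rw [rank_setFlattening_pairTensor, hSc]

end Pair

/-! ## §3 The restricted sum of ordered programs -/

/-- **Pair restriction of a `ΣosmABP` for `per_N`.** From `IsSumOrdered F N t W`: block orders and widths
(`∑ w i ≤ W`) such that for EVERY matching `(S, e)` the pair tensor is the sum of `t` layer-local ordered
programs, program `i` of width `w i` reading column `σ i p` at layer `p` (all `N` layers variable).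
[cite: ChatterjeeKushSarafShpilka2024, §1.2; ArvindRaja2016, §3] -/
theorem pair_restriction {N t W : ℕ} (h : IsSumOrdered F N t W) :
    ∃ (σ : Fin t → Equiv.Perm (Fin N)) (w : Fin t → ℕ), ∑ i, w i ≤ W ∧
      ∀ (S : Finset (Fin N)) (e : {c // c ∈ S} ≃ {c // c ∉ S}),
        ∃ B' : Fin t → (Fin N → Fin 2) → F,
          (∀ i, HasOsmWidthLE (w i) (fun p => some (σ i p)) (B' i)) ∧
            ∀ j, ∑ i, B' i j = pairTensor S e j := by
  obtain ⟨σ, w, hsum, hall⟩ := transfer_uniform h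
  refine ⟨σ, w, hsum, fun S e => ?_⟩
  obtain ⟨B', hB', hT⟩ := hall N 2 (fun c => some c) (pairRow S e) (fun _ _ => 0)
  refine ⟨B', hB', fun j => ?_⟩
  rw [hT j, transferTensor_some, perWord_pairRow]

end Summit.ValiantsHypothesis.ValiantsHypothesis.Theorems.OrderedCountWindow
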